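import Summits.Ventures.PercRepro.S2SetCountGiant

/-!
# PercRepro — S2: THE LEVEL COUNT INDEXED BY SPANNING SETS, PART C — THE PARTITION COUNT IN `ℚ` (p7, gen 3; S2)

`ncard_eRk_eq_ncard_le_le_sets`: for every finite matroid with circuits of `≥ 3` elements, lines of `≤ 3` points,
rank-`≤ q` sets of `≤ f` points, rank-`≤ q − 1` sets of `≤ f′` points and nullity `≤ ν_∩`, `|E| = r(E) + d`,
`d + ν_∩ < 2ν₁`, and the termwise weight order `f′ − q ≤ min(f − q − 1, ν₁ − 2) ≤ min(f, q + d) − q − 1`: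
`#{B ⊆ E : r(B) = q, |B| ≤ D} ≤ C(n, q) + σ_m·Σ_k s_k·C(n − k, q + 1 − k) + (σ_g − σ_m)·C(min(f, q + d), q + 1)`
with `σ_x = Σ_{j ≤ D − q − 1} C(x, j)/(j + 1 + 3·C(j + 1, 2))`. The proof is the partition form of
S2SquareGiantCount3D with the spanning sets in place of the pairs; the giant term is the binomial of the one giant
flat (`card_spanGiant_le`). Axioms: standard.
-/

open scoped Matroid

namespace PercRepro

namespace S2

open Set Finset

variable {α : Type} {M : Matroid α}

open scoped Classical in
/-- **THE PARTITION COUNT OVER SPANNING SETS, WITH A SIZE BOUND `D`**: the small, mid and giant spanning sets partition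
`spanAll`, so with `σ_s ≤ σ_m ≤ σ_g` (termwise: `f′ − q ≤ min(f − q − 1, ν₁ − 2) ≤ F_max − q − 1`)
`#{B ⊆ E : r(B) = q, |B| ≤ D} ≤ C(n, q) + σ_m·Σ_k s_k·C(n − k, q + 1 − k) + (σ_g − σ_m)·C(F_max, q + 1)` (sums to
`D − q − 1`) — the mid weight on all spanning sets (bounded by the sharp pair count), the giant excess on the
`(q + 1)`-subsets of the one giant flat. -/
theorem ncard_eRk_eq_ncard_le_le_sets (M : Matroid α) [M.Finite] (q f f' ν₁ νi D : ℕ) (hq : 1 ≤ q)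
    (hcirc : ∀ C, M.IsCircuit C → 3 ≤ C.encard) (hC1 : ∀ L ⊆ M.E, M.eRk L = 2 → L.ncard ≤ 3)
    (hflat : ∀ X ⊆ M.E, M.eRk X ≤ q → X.ncard ≤ f)
    (hflat' : ∀ X ⊆ M.E, M.eRk X ≤ (q - 1 : ℕ) → X.ncard ≤ f')
    (hinter : ∀ X ⊆ M.E, M.eRk X ≤ (q - 1 : ℕ) → (X.ncard : ℕ∞) ≤ M.eRk X + νi)
    {d : ℕ} (hd : M.E.encard = M.eRank + d) (h2 : d + νi < 2 * ν₁)
    (hσm : f' - q ≤ min (f - (q + 1)) (ν₁ - 2)) (hσg : min (f - (q + 1)) (ν₁ - 2) ≤ min f (q + d) - (q + 1)) :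
    ({B : Set α | B ⊆ M.E ∧ M.eRk B = q ∧ B.ncard ≤ D}.ncard : ℚ) ≤
      (M.E.ncard.choose q : ℚ) +
        (∑ j ∈ Finset.range (D - (q + 1) + 1), ((min (f - (q + 1)) (ν₁ - 2)).choose j : ℚ) / (((j + 1) + 3 * (j + 1).choose 2 : ℕ) : ℚ)) *
          (∑ k ∈ Finset.Icc 3 (q + 1),
            ({C | M.IsCircuit C ∧ C.ncard = k}.ncard : ℚ) * ((M.E.ncard - k).choose (q + 1 - k) : ℚ)) +
        ((∑ j ∈ Finset.range (D - (q + 1) + 1), ((min f (q + d) - (q + 1)).choose j : ℚ) / (((j + 1) + 3 * (j + 1).choose 2 : ℕ) : ℚ)) -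
          (∑ j ∈ Finset.range (D - (q + 1) + 1), ((min (f - (q + 1)) (ν₁ - 2)).choose j : ℚ) / (((j + 1) + 3 * (j + 1).choose 2 : ℕ) : ℚ))) *
          ((min f (q + d)).choose (q + 1) : ℚ) := by
  set Ef := Matroid.groundF M with hEf
  have hE : (Ef : Set α) = M.E := Matroid.coe_groundF M
  have hEcard : Ef.card = M.E.ncard := Matroid.card_groundF M
  set S := {B : Set α | B ⊆ M.E ∧ M.eRk B = q ∧ B.ncard ≤ D} with hS
  set S₁ := {B : Set α | B ⊆ (Ef : Set α) ∧ B.ncard = q} with hS₁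
  set S₂ := {B : Set α | B ⊆ M.E ∧ M.eRk B = q ∧ q < B.ncard ∧ B.ncard ≤ D} with hS₂
  have hsplit : S ⊆ S₁ ∪ S₂ := by
    intro B hB
    have hBfin : B.Finite := M.ground_finite.subset hB.1
    have hle : q ≤ B.ncard := by
      have := M.eRk_le_encard B
      rw [hB.2.1, ← hBfin.cast_ncard_eq] at this
      exact_mod_cast this
    rcases hle.lt_or_eq with h | h
    · exact Or.inr ⟨hB.1, hB.2.1, h, hB.2.2⟩
    · exact Or.inl ⟨by rw [hE]; exact hB.1, h.symm⟩
  have hS₁fin : S₁.Finite := (Ef.finite_toSet.finite_subsets).subset (fun B hB => hB.1)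
  have hS₂fin : S₂.Finite := M.ground_finite.finite_subsets.subset (fun B hB => hB.1)
  have hS₁ : S₁.ncard = M.E.ncard.choose q := by
    rw [hS₁, ncard_subsets_ncard_eq Ef q, hEcard]
  set Ps := (spanSmall M q f').card with hPs
  set Pm := (spanMid M q f' ν₁).card with hPm
  set Pg := (spanGiant M q f' ν₁).card with hPg
  set Fm := min f (q + d) with hFm
  have hlevel : ∀ m ∈ Finset.Icc (q + 1) D, ((Matroid.levelF M q m).card : ℚ) ≤
      ((Ps : ℚ) * ((f' - q).choose (m - (q + 1)) : ℚ) + (Pm : ℚ) * ((min (f - (q + 1)) (ν₁ - 2)).choose (m - (q + 1)) : ℚ) +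
        (Pg : ℚ) * ((Fm - (q + 1)).choose (m - (q + 1)) : ℚ)) / (((m - q) + 3 * (m - q).choose 2 : ℕ) : ℚ) := by
    intro m hm
    rw [Finset.mem_Icc] at hm
    have hmq : 0 < m - q := by omega
    have hpos : (0 : ℚ) < (((m - q) + 3 * (m - q).choose 2 : ℕ) : ℚ) := by
      exact_mod_cast (by omega : 0 < (m - q) + 3 * (m - q).choose 2)
    rw [le_div_iff₀ hpos]
    have h := mul_card_levelF_le_classes q f f' ν₁ hq hcirc hC1 hflat hd m
    have h' : ((((m - q) + 3 * (m - q).choose 2) * (Matroid.levelF M q m).card : ℕ) : ℚ) ≤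
        ((Ps * (f' - q).choose (m - (q + 1)) + Pm * (min (f - (q + 1)) (ν₁ - 2)).choose (m - (q + 1)) +
          Pg * (Fm - (q + 1)).choose (m - (q + 1)) : ℕ) : ℚ) := by
      exact_mod_cast h
    push_cast at h' ⊢
    linarith
  have hS₂q : (S₂.ncard : ℚ) ≤ ∑ m ∈ Finset.Icc (q + 1) D,
      ((Ps : ℚ) * ((f' - q).choose (m - (q + 1)) : ℚ) + (Pm : ℚ) * ((min (f - (q + 1)) (ν₁ - 2)).choose (m - (q + 1)) : ℚ) +
        (Pg : ℚ) * ((Fm - (q + 1)).choose (m - (q + 1)) : ℚ)) / (((m - q) + 3 * (m - q).choose 2 : ℕ) : ℚ) := by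
    calc (S₂.ncard : ℚ) ≤ ((∑ m ∈ Finset.Icc (q + 1) D, (Matroid.levelF M q m).card : ℕ) : ℚ) := by
          exact_mod_cast Matroid.ncard_dep_le_sum_levelF q D
      _ = ∑ m ∈ Finset.Icc (q + 1) D, ((Matroid.levelF M q m).card : ℚ) := by push_cast; rfl
      _ ≤ _ := Finset.sum_le_sum hlevel
  have hre : ∑ m ∈ Finset.Icc (q + 1) D,
      ((Ps : ℚ) * ((f' - q).choose (m - (q + 1)) : ℚ) + (Pm : ℚ) * ((min (f - (q + 1)) (ν₁ - 2)).choose (m - (q + 1)) : ℚ) +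
        (Pg : ℚ) * ((Fm - (q + 1)).choose (m - (q + 1)) : ℚ)) / (((m - q) + 3 * (m - q).choose 2 : ℕ) : ℚ) =
      ∑ j ∈ Finset.range (D - q),
      ((Ps : ℚ) * ((f' - q).choose j : ℚ) + (Pm : ℚ) * ((min (f - (q + 1)) (ν₁ - 2)).choose j : ℚ) +
        (Pg : ℚ) * ((Fm - (q + 1)).choose j : ℚ)) / (((j + 1) + 3 * (j + 1).choose 2 : ℕ) : ℚ) := by
    rw [show Finset.Icc (q + 1) D = Finset.image (fun j => q + 1 + j) (Finset.range (D - q)) from ?_]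
    · rw [Finset.sum_image (fun a _ b _ h => by omega)]
      apply Finset.sum_congr rfl
      intro j _
      rw [show q + 1 + j - (q + 1) = j by omega, show q + 1 + j - q = j + 1 by omega]
    · ext m
      rw [Finset.mem_Icc, Finset.mem_image]
      constructor
      · intro hm
        exact ⟨m - (q + 1), by rw [Finset.mem_range]; omega, by omega⟩
      · rintro ⟨j, hj, rfl⟩
        rw [Finset.mem_range] at hj
        omega
  have hrange : Finset.range (D - q) ⊆ Finset.range (D - (q + 1) + 1) := Finset.range_mono (by omega)
  have hS₂q' : (S₂.ncard : ℚ) ≤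
      (Ps : ℚ) * ∑ j ∈ Finset.range (D - (q + 1) + 1), ((f' - q).choose j : ℚ) / (((j + 1) + 3 * (j + 1).choose 2 : ℕ) : ℚ) +
      (Pm : ℚ) * ∑ j ∈ Finset.range (D - (q + 1) + 1), ((min (f - (q + 1)) (ν₁ - 2)).choose j : ℚ) / (((j + 1) + 3 * (j + 1).choose 2 : ℕ) : ℚ) +
      (Pg : ℚ) * ∑ j ∈ Finset.range (D - (q + 1) + 1), ((Fm - (q + 1)).choose j : ℚ) / (((j + 1) + 3 * (j + 1).choose 2 : ℕ) : ℚ) := by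
    rw [Finset.mul_sum, Finset.mul_sum, Finset.mul_sum, ← Finset.sum_add_distrib, ← Finset.sum_add_distrib]
    refine hS₂q.trans (hre.le.trans ?_)
    refine Finset.sum_le_sum_of_subset_of_nonneg hrange (fun j _ _ => by positivity) |>.trans' ?_
    apply le_of_eq
    apply Finset.sum_congr rfl
    intro j _
    field_simp
  -- the class counts: the partition `Ps + Pm + Pg = #spanAll ≤ #pairsF ≤ P′_E`, and the giant count
  have hpart : Ps + Pm + Pg = (spanAll M q).card := by
    have h1 : (spanSmall M q f').card + (spanBig M q f').card = (spanAll M q).card := by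
      unfold spanSmall spanBig
      exact Finset.card_filter_add_card_filter_not _
    have h2 : (spanGiant M q f' ν₁).card + (spanMid M q f' ν₁).card = (spanBig M q f').card := by
      unfold spanGiant spanMid
      exact Finset.card_filter_add_card_filter_not _
    omega
  have hFq : ((spanAll M q).card : ℚ) ≤ ∑ k ∈ Finset.Icc 3 (q + 1),
      ({C | M.IsCircuit C ∧ C.ncard = k}.ncard : ℚ) * ((M.E.ncard - k).choose (q + 1 - k) : ℚ) := by
    have h1 := card_spanAll_le q hcirc
    have h2 := Matroid.card_pairsF_le' (M := M) q
    have : (((spanAll M q).card : ℕ) : ℚ) ≤ ((∑ k ∈ Finset.Icc 3 (q + 1),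
        {C | M.IsCircuit C ∧ C.ncard = k}.ncard * (M.E.ncard - k).choose (q + 1 - k) : ℕ) : ℚ) := by
      exact_mod_cast h1.trans h2
    push_cast at this
    exact this
  have hPgq : (Pg : ℚ) ≤ (Fm.choose (q + 1) : ℚ) := by
    have h2 := card_spanGiant_le (M := M) (ν₁ := ν₁) hq hcirc hflat hflat' hinter hd h2
    exact_mod_cast h2
  -- the weights: `σ_s ≤ σ_m ≤ σ_g` termwise
  set σs : ℚ := ∑ j ∈ Finset.range (D - (q + 1) + 1), ((f' - q).choose j : ℚ) / (((j + 1) + 3 * (j + 1).choose 2 : ℕ) : ℚ) with hσs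
  set σm : ℚ := ∑ j ∈ Finset.range (D - (q + 1) + 1), ((min (f - (q + 1)) (ν₁ - 2)).choose j : ℚ) / (((j + 1) + 3 * (j + 1).choose 2 : ℕ) : ℚ)
    with hσmdef
  set σg : ℚ := ∑ j ∈ Finset.range (D - (q + 1) + 1), ((Fm - (q + 1)).choose j : ℚ) / (((j + 1) + 3 * (j + 1).choose 2 : ℕ) : ℚ) with hσgdef
  have hσs0 : (0 : ℚ) ≤ σs := Finset.sum_nonneg (fun j _ => by positivity)
  have hsm : σs ≤ σm := by
    apply Finset.sum_le_sum
    intro j _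
    have : (f' - q).choose j ≤ (min (f - (q + 1)) (ν₁ - 2)).choose j := Nat.choose_le_choose j hσm
    have h' : ((f' - q).choose j : ℚ) ≤ ((min (f - (q + 1)) (ν₁ - 2)).choose j : ℚ) := by exact_mod_cast this
    exact div_le_div_of_nonneg_right h' (by positivity)
  have hmg : σm ≤ σg := by
    apply Finset.sum_le_sum
    intro j _
    have : (min (f - (q + 1)) (ν₁ - 2)).choose j ≤ (Fm - (q + 1)).choose j := Nat.choose_le_choose j hσg
    have h' : ((min (f - (q + 1)) (ν₁ - 2)).choose j : ℚ) ≤ ((Fm - (q + 1)).choose j : ℚ) := by exact_mod_cast this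
    exact div_le_div_of_nonneg_right h' (by positivity)
  have hSq : (S.ncard : ℚ) ≤ (S₁.ncard : ℚ) + (S₂.ncard : ℚ) := by
    have : S.ncard ≤ S₁.ncard + S₂.ncard :=
      (ncard_le_ncard hsplit (hS₁fin.union hS₂fin)).trans (ncard_union_le _ _)
    exact_mod_cast this
  rw [hS₁] at hSq
  have hpartq : (Ps : ℚ) + Pm + Pg = ((spanAll M q).card : ℚ) := by exact_mod_cast hpart
  have hPs0 : (0 : ℚ) ≤ Ps := Nat.cast_nonneg _
  have hPm0 : (0 : ℚ) ≤ Pm := Nat.cast_nonneg _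
  have hPg0 : (0 : ℚ) ≤ Pg := Nat.cast_nonneg _
  have hσm0 : (0 : ℚ) ≤ σm := hσs0.trans hsm
  -- `σs·Ps + σm·Pm + σg·Pg ≤ σm·(Ps + Pm + Pg) + (σg − σm)·Pg`
  have key : (Ps : ℚ) * σs + (Pm : ℚ) * σm + (Pg : ℚ) * σg ≤
      ((spanAll M q).card : ℚ) * σm + (σg - σm) * Pg := by
    rw [← hpartq]
    nlinarith [mul_le_mul_of_nonneg_left hsm hPs0]
  have e1 := mul_le_mul_of_nonneg_right hFq hσm0
  have e3 := mul_le_mul_of_nonneg_left hPgq (by linarith : (0 : ℚ) ≤ σg - σm)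
  calc (S.ncard : ℚ) ≤ (M.E.ncard.choose q : ℚ) + (S₂.ncard : ℚ) := hSq
    _ ≤ _ := by linarith [hS₂q', key, e1, e3]

end S2

end PercRepro
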